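import Summits.Parity.GeneralizedHardyLittlewood.Theses.LeeYangFibres
import Literature.NumberTheory.Sieve.LinearEquationsInPrimesTwinSystem
import Literature.NumberTheory.Sieve.ParityWave0
import HarnessLib

/-!
# Route `LeeYangFibres`, support `RelativeDimOne` (stmt-Parity-14113): logical position

`RelativeDimOne` is the `d = 1` generalised Hardy–Littlewood statement (von Mangoldt form, uniform
over non-degenerate systems of `t` forms of size `≤ L` and convex `K ⊆ [-N, N]`) with the
*relative + absolute* error `ε (β_∞ ∏_p β_p + N)` of Green–Tao's Conjecture 1.4, whereas the route
target `DimOne` (stmt-Parity-0819) carries the absolute error `ε N`.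

This file records, sorry-free:

* `relativeDimOne_of_dimOne : DimOne → RelativeDimOne` — the absolute form implies the relative
  form. No convergence of the singular product is needed: from `|S - M| ≤ ε' N` and `S ≥ 0` one
  gets `M ≥ -ε' N`, so `ε (M + N) ≥ ε N / 2 ≥ ε' N` for `ε' = min ε 1 / 2`.

(The converse, `AbsoluteUpgrade : RelativeDimOne → DimOne`, is the route's declared residual
stmt-Parity-14116 and is not addressed here.)
-/

namespace Summit.Parity.GeneralizedHardyLittlewood.Theorems.LeeYangFibresRelativeDimOne

open Literature.NumberTheory.Sieve
open Summit.Parity.GeneralizedHardyLittlewood.Theses.LeeYangFibres (DimOne RelativeDimOne)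

/-- The von Mangoldt sum `∑_{n ∈ K ∩ ℤ^d} ∏ᵢ Λ(ψᵢ(n))` is non-negative (each `Λ ≥ 0`). -/
theorem vonMangoldtSum_nonneg {d t : ℕ} (Ψ : Fin t → AffLinForm d) (K : Set (Fin d → ℝ))
    (N : ℕ) : 0 ≤ vonMangoldtSum Ψ K N := by
  unfold vonMangoldtSum
  exact Finset.sum_nonneg fun n _ =>
    Finset.prod_nonneg fun i _ => ArithmeticFunction.vonMangoldt_nonneg

/-- **`DimOne → RelativeDimOne`**: the absolute-error form of the `d = 1` Hardy–Littlewood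
statement implies the relative-error form. Given `ε`, apply `DimOne` with `ε' = min ε 1 / 2`;
since the von Mangoldt sum is `≥ 0`, `|S - M| ≤ ε' N` forces `M ≥ -N/2`, whence
`ε (M + N) ≥ ε N / 2 ≥ ε' N ≥ |S - M|`. -/
theorem relativeDimOne_of_dimOne (h : DimOne) : RelativeDimOne := by
  intro t L ht ε hε
  obtain ⟨N₀, hN₀⟩ := h t L ht (min ε 1 / 2) (by positivity)
  refine ⟨N₀, fun N hN Ψ hΨ hL K hK hKN => ?_⟩
  have hb := hN₀ N hN Ψ hΨ hL K hK hKN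
  have hS := vonMangoldtSum_nonneg Ψ K N
  set S := vonMangoldtSum Ψ K N with hSdef
  set M := archFactor Ψ K * singularProduct Ψ with hMdef
  have hN0 : (0 : ℝ) ≤ N := Nat.cast_nonneg N
  have hε1 : min ε 1 / 2 ≤ ε / 2 := by
    have := min_le_left ε 1
    linarith
  have hε2 : min ε 1 / 2 ≤ 1 / 2 := by
    have := min_le_right ε 1
    linarith
  have hab := abs_le.mp hb
  -- `M ≥ -(1/2) N`
  have hM : -(1 / 2 * (N : ℝ)) ≤ M := by
    have h1 : min ε 1 / 2 * (N : ℝ) ≤ 1 / 2 * N := mul_le_mul_of_nonneg_right hε2 hN0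
    linarith [hab.1, hab.2]
  -- `ε M ≥ -(ε/2) N`
  have hεM : -(ε / 2 * (N : ℝ)) ≤ ε * M := by
    have := mul_le_mul_of_nonneg_left hM hε.le
    linarith
  have h2 : min ε 1 / 2 * (N : ℝ) ≤ ε / 2 * N := mul_le_mul_of_nonneg_right hε1 hN0
  calc |S - M| ≤ min ε 1 / 2 * (N : ℝ) := hb
    _ ≤ ε * (M + N) := by nlinarith

end Summit.Parity.GeneralizedHardyLittlewood.Theorems.LeeYangFibresRelativeDimOne

/-!
## Hardness certificate: `RelativeDimOne → TwinPrimeConjecture`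

Specialised to the twin-prime system `n ↦ (n, n + 2)` (Green–Tao 2010, Example 1; tree
dictionary `Literature.NumberTheory.Sieve.LinearEquationsInPrimesTwinSystem`: `‖Ψ‖_N ≤ 3`,
`β_∞([-N, N]) = N`, the von Mangoldt sum is `∑_{n=1}^{N} Λ(n)Λ(n+2)`, `𝔖 = ∏_p β_p ≥ 1`) and the
full box `K = [-N, N]`, the item pins `∑_{n ≤ N} Λ(n) Λ(n+2)` to `(𝔖 + o(1)) N`, so it is
`≥ N/2` for large `N` (`twinSum_ge_of_relativeDimOne`); without twin primes beyond `n₀` the same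
sum is `≤ log(N+2) (ψ(n₀) + 2 C √(N+2)) = O(N^{3/4})` (`twinCorrelation_le_of_no_twinPrimes` and
Chebyshev's `ψ - θ ≤ C √x` from Mathlib). Hence `twinPrimeConjecture_of_relativeDimOne`: the
item implies `Literature.NumberTheory.Sieve.TwinPrimeConjecture`, a registered open conjecture —
it cannot be closed short of the twin prime conjecture (in Hardy–Littlewood strength).
-/

namespace Summit.Parity.GeneralizedHardyLittlewood.Theorems.LeeYangFibresRelativeDimOne

open Literature.NumberTheory.Sieve Finset Filter
open scoped ArithmeticFunction.vonMangoldt Chebyshev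
open Summit.Parity.GeneralizedHardyLittlewood.Theses.LeeYangFibres (RelativeDimOne)

/-- **`RelativeDimOne ⟹ ∑_{n ≤ N} Λ(n) Λ(n+2) ≥ N/2` for all large `N`**: apply the item with
`t = 2`, `L = 3`, `ε = 1/4` to the twin-prime system and `K = [-N, N]`, where `β_∞ = N` and
`𝔖 ≥ 1`: `S ≥ N𝔖 - (N𝔖 + N)/4 ≥ N/2`. -/
theorem twinSum_ge_of_relativeDimOne (h : RelativeDimOne) :
    ∃ N₁ : ℕ, ∀ N : ℕ, N₁ ≤ N → (N : ℝ) / 2 ≤ ∑ n ∈ Icc 1 N, Λ n * Λ (n + 2) := by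
  obtain ⟨N₀, hN₀⟩ := h 2 3 (by norm_num) (1 / 4) (by norm_num)
  refine ⟨max N₀ 2, fun N hN => ?_⟩
  have hN2 : 2 ≤ N := le_of_max_le_right hN
  have hconv : Convex ℝ (realBox 1 (N : ℝ)) := convex_Icc _ _
  have hb := hN₀ N (le_of_max_le_left hN) twinPrimeSystem isNondegenerateSystem_twinPrimeSystem.1
    (by exact_mod_cast affLinSize_twinPrimeSystem_le hN2) (realBox 1 N) hconv subset_rfl
  rw [vonMangoldtSum_twinPrimeSystem, archFactor_twinPrimeSystem] at hb
  have hS := one_le_singularProduct_twinPrimeSystem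
  have hN0 : (0 : ℝ) ≤ N := Nat.cast_nonneg N
  have h1 := (abs_le.mp hb).1
  nlinarith [mul_nonneg hN0 (by linarith : (0 : ℝ) ≤ singularProduct twinPrimeSystem - 1)]

/-- **Hardness certificate: `RelativeDimOne` implies the twin prime conjecture.**
By `twinSum_ge_of_relativeDimOne` the correlation `∑_{n ≤ N} Λ(n)Λ(n+2)` is `≥ N/2` for
large `N`; if twin primes were bounded by `n₀`, `twinCorrelation_le_of_no_twinPrimes` and
Chebyshev's `ψ - θ ≤ C√x` would bound it by `log(N+2)(A + 2C√(N+2))` — writing `N + 2 = z⁴`,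
`log(N+2) ≤ 4z`, the two bounds are incompatible once `z ≥ 16C + 8A + 3`. -/
theorem twinPrimeConjecture_of_relativeDimOne (h : RelativeDimOne) : TwinPrimeConjecture := by
  by_contra hT
  unfold TwinPrimeConjecture at hT
  push Not at hT
  obtain ⟨n₀, hn₀⟩ := hT
  have hno : ∀ n, n₀ < n → ¬ (n.Prime ∧ (n + 2).Prime) := fun n hn h2 => hn₀ n hn h2.1 h2.2
  obtain ⟨N₁, hN₁⟩ := twinSum_ge_of_relativeDimOne h
  obtain ⟨C₀, hC₀⟩ := Chebyshev.psi_sub_theta_le_mul_sqrt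
  set C := max C₀ 0 with hCdef
  have hC0 : 0 ≤ C := le_max_right _ _
  have hC : ∀ x : ℝ, 0 ≤ x → ψ x - θ x ≤ C * Real.sqrt x := fun x _ =>
    (hC₀ x).trans (mul_le_mul_of_nonneg_right (le_max_left _ _) (Real.sqrt_nonneg x))
  set A := ∑ n ∈ Icc 1 n₀, Λ n with hAdef
  have hA0 : 0 ≤ A := Finset.sum_nonneg fun _ _ => ArithmeticFunction.vonMangoldt_nonneg
  -- the scale: `N + 2 = z⁴` with `z ≥ z₀ := 16 C + 8 A + 3`
  set z₀ : ℝ := 16 * C + 8 * A + 3 with hz₀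
  have hz₀3 : 3 ≤ z₀ := by rw [hz₀]; linarith
  set N := max N₁ ⌈z₀ ^ 4⌉₊ with hNdef
  have hNN₁ : N₁ ≤ N := le_max_left _ _
  have hmax : ⌈z₀ ^ 4⌉₊ ≤ N := le_max_right _ _
  have hNz : z₀ ^ 4 ≤ N := (Nat.le_ceil _).trans (by exact_mod_cast hmax)
  have hN0 : (0 : ℝ) ≤ N := Nat.cast_nonneg N
  set x : ℝ := (N : ℝ) + 2 with hx
  have hx0 : 0 < x := by rw [hx]; linarith
  set z : ℝ := Real.sqrt (Real.sqrt x) with hz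
  have hz0 : 0 ≤ z := Real.sqrt_nonneg _
  have hz2 : z ^ 2 = Real.sqrt x := by rw [hz, Real.sq_sqrt (Real.sqrt_nonneg x)]
  have hz4 : z ^ 4 = x := by
    rw [show z ^ 4 = (z ^ 2) ^ 2 by ring, hz2, Real.sq_sqrt hx0.le]
  have hzz₀ : z₀ ≤ z := by
    by_contra hlt
    push Not at hlt
    have : z ^ 4 < z₀ ^ 4 := by gcongr
    rw [hz4, hx] at this
    linarith
  have hz1 : 1 ≤ z := by linarith
  -- `log x = 4 log z ≤ 4 z`
  have hlog : Real.log x ≤ 4 * z := by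
    have hzpos : 0 < z := by linarith
    rw [← hz4, Real.log_pow]
    have := Real.log_le_sub_one_of_pos hzpos
    push_cast
    linarith
  -- lower bound at `N`
  have hlow := hN₁ N hNN₁
  -- upper bound at `N`
  have hup := twinCorrelation_le_of_no_twinPrimes hno N
  have hψN : ψ N - θ N ≤ C * z ^ 2 := by
    refine (hC N hN0).trans (mul_le_mul_of_nonneg_left ?_ hC0)
    rw [hz2]
    exact Real.sqrt_le_sqrt (by rw [hx]; linarith)
  have hcast : ((N + 2 : ℕ) : ℝ) = x := by rw [hx]; push_cast; ring
  have hψN2 : ψ x - θ x ≤ C * z ^ 2 := by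
    have := hC x hx0.le
    rwa [hz2]
  rw [hcast, ← hx] at hup
  have hbig : ∑ n ∈ Icc 1 N, Λ n * Λ (n + 2) ≤ 4 * z * (A + 2 * (C * z ^ 2)) := by
    refine hup.trans ?_
    have hin : A + (ψ N - θ N) + (ψ x - θ x) ≤ A + 2 * (C * z ^ 2) := by linarith
    have hin0 : 0 ≤ A + (ψ N - θ N) + (ψ x - θ x) := by
      have h1 := Chebyshev.theta_le_psi (N : ℝ)
      have h2 := Chebyshev.theta_le_psi x
      linarith
    calc Real.log x * _ ≤ 4 * z * _ := mul_le_mul_of_nonneg_right hlog hin0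
      _ ≤ 4 * z * (A + 2 * (C * z ^ 2)) := mul_le_mul_of_nonneg_left hin (by linarith)
  -- combine: `N/2 = (z⁴ - 2)/2 ≤ 4 A z + 8 C z³`, impossible for `z ≥ z₀`
  have hNx : (N : ℝ) = z ^ 4 - 2 := by rw [hz4, hx]; ring
  rw [hNx] at hlow
  have key : z ^ 4 ≤ 8 * A * z + 16 * C * z ^ 3 + 2 := by linarith
  have hz3 : z ≤ z ^ 3 := by
    have h' : 0 ≤ z * ((z - 1) * (z + 1)) := mul_nonneg hz0 (mul_nonneg (by linarith) (by linarith))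
    linarith [h', show z * ((z - 1) * (z + 1)) = z ^ 3 - z by ring]
  have h5 : z₀ * z ^ 3 ≤ z ^ 4 := by
    have h' := mul_le_mul_of_nonneg_right hzz₀ (pow_nonneg hz0 3)
    linarith [h', show z * z ^ 3 = z ^ 4 by ring]
  rw [hz₀] at h5
  linarith [mul_nonneg hA0 (sub_nonneg.mpr hz3)]

end Summit.Parity.GeneralizedHardyLittlewood.Theorems.LeeYangFibresRelativeDimOne
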